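import Literature.MathematicalPhysics.QuantumFieldTheory.Balaban1983to89.T4ShellMeasurePolar
import Literature.MathematicalPhysics.QuantumFieldTheory.Balaban1983to89.T4ShellMeasureSMPlacement

/-!
# T4ShellMeasureLocal — node U5b/U5.E, cell input NE7c = `T4IndicatorShell.ShellWeightBound`, member (γ_loc) of the
shell-measure route: the LOCAL DILATION — only the slot's own block of variables is contracted towards its flat point,
everything else is frozen; (M1) integrates over the frozen exterior; kept co-tests ride inside the dilated density;
the reach is the size of the slot's localization cube, polylog in the coupling by (2.5), so the separation-of-scales
binder (SM) PLACES on branch (A) at ALL live levels; v2 (§8): the mass-ratio binder (MR) PLACED IN KIND too — a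
polylog count of dropped co-tests against the printed large-field small factor `exp(−c·p₀(g))` (B16 (1.89)) is a
«g ≤ g₁» clause, ONE `g₁`

(cell `pub-balaban`, T4-DAG v24 §6 row NE7c, fan-out seat `b2b-balaban-t4-ne7c-p1` gen 11, design rows
T4-U5b.E2-NE7c-PROVE-P1m* (v1, §1–§7) and -P1n* (v2, §8); imports `T4ShellMeasurePolar` (hence `T4ShellMeasureAnalytic`, `T4ShellMeasureFibre`,
`T4ShellMeasure`: `SlotAntiConcentration`, `FibreAlternative`, `FwdLogLipschitzOn`, `TwoSidedBelow`, `fibreCoef`,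
`polarDensity`, `dilate`, `slotAntiConcentration_withDensity`, consumed BY NAME) and `T4ShellMeasureSMPlacement` (hence
`SMPlacement`, `smPlacement_of_polylogEnvelope`, `exists_threshold_logInvSq_pow`, `B14.IsRj` = (2.5), `B14.alphaJ` =
(2.28), `B14FlowStep.isRj_le_mul_logpow`, `Setup`'s `Flow` / `Flow.InInterval` / `epsK` / `p0Profile`, `Step.FundIneq189` =
the printed shape (1.89), consumed BY NAME); companion record `t4/T4-EST-NE7c-P1.md` §3 (γ_loc) / §5, GAPS
G-ne7cp1-9, -11a, -14, -16, -17, -18; PURE MEASURE THEORY AND REAL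
ANALYSIS, [folklore], 0 sorry: Tonelli, monotonicity, one union bound, monotone arithmetic; every located input a
binder.)

HONEST FRAMING (T4-DAG PAGE 1).  Rung (B)+1 scoping of the T⁴-continuum cell: existence and uniqueness of the `ε → 0`
limit of unit-scale averaged expectations on a FIXED finite torus — NOT infinite volume, NOT a mass gap, NOT Clay, and
NOT a proof of NE7c.  Nothing of the run-A/run-B comparison is printed in [Balaban 1983–89]; nothing printed is
asserted here and no constant of Bałaban's is chosen.  Every conditional of the cell (BetaPertH, (B), (B^μ)) stays where
it is — upstream of the term families, untouched, to be displayed BY NAME by the consumer.  The READINGS named below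
((Det), (FI), (LR), (DC-loc), (MR), (AN-bound)) are located readings of the record, NOT printed as lemmas and NOT
kernel: they enter as HYPOTHESES, never as facts.

WHY THIS LEAF.  Gen 10 (`T4ShellMeasureSMPlacement` §3 (C), GAPS G-ne7cp1-16) showed that member (γ″) with a GLOBAL
dilation of the level-`j` lattice cannot place its one numerical binder (SM) in the small-coupling regime: the reach of
a global axial chart grows with the linear size of the lattice, the live window has print's CAP depth `N = R_j`
(B16 p.384), and then the placement (PL) is FALSE at the oldest live level for every small coupling
(`not_smPlacement_of_isRj`, under print's own (2.5)).  The gap row names the escape: «an age-uniform reach».  Print's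
tested variables ARE local — B14 (2.16): the slot variable `U_{k,□}(V_k)` is the minimiser of a determining set
supported in the cube `□^{∼4}`, cubes of size `L M₂ R_k`; B15 (1.19)–(1.20): the functions `U^{(n)}_{k,Z}` are
«localized in the region Z», components «contained in a cube of the size 100 M R_k» — so a dilation of the slot's OWN
block of variables has reach of the order of the cube's side, `R_j` = a fixed power of `log g_j⁻²` by (2.5): POLYLOG,
age-uniform in the sense that matters (branch (A) of gen 10's fork at every live level, ONE threshold `g₀`).  Dilating
only a block raises two issues the global members did not have, and this leaf settles both in kernel shape:
(1) the law is no longer a product adapted to the dilation — answered by §1: (M1) is LINEAR in the measure, so it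
    integrates over any frozen exterior (Tonelli), and the Polar leaf applies section by section (§2);
(2) the other slots' indicator factors share variables with the block (the record's dead end D11: a territory
    dilation flips neighbouring tests at the interface) — answered by the KEPT/DROPPED dichotomy of §3/§5: a co-test
    that is NON-DECREASING along the contraction (a neighbouring slot fully inside the block passes for ever once it
    passes, by the two-sidedness of its log-variable = the located (AN)-rate; a fluctuation bound `‖·‖ < p` is
    forward-invariant; the forward-SATURATED local small-field set is forward-invariant by construction) multiplies
    the fibre density at forward-log-Lipschitz cost ZERO and stays INSIDE the dilated density (shell domination then
    automatic, no flip); the finitely many co-tests that are not (plaquettes straddling the block's boundary, the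
    slot's own indicator) are DROPPED into the dominating law at the price of a MASS RATIO `M`, which one union bound
    makes `2` from per-test failure fractions of the printed small-factor KIND.
And the MULTIPLICITY factor of the global members (one dilation serving every slot of the level, `T4ShellMeasureFibre`
`mult`) is GONE: each slot has its own block; what replaces it is `M`.

THE MEMBER (γ_loc) — DICTIONARY (readings → the hypotheses of §2/§6; nothing here is asserted about Bałaban's objects).
Configuration space of the ONE pending fluctuation integral in which the slot's shell piece is born = `E × Z`:
`E` = the slot's block (axial gauge on a spanning tree of the localization cube `Det(u_s)`; exponential chart of the
non-tree internal link variables and the block's fluctuation variables; flat configuration at `0`; `dim E = n_loc`),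
Lebesgue measure `μ`; `Z` = every other variable (crossing links, exterior, other levels) with its law `ζ` (any
s-finite measure: densities w.r.t. it are never needed).  Dominating law `μ′ = (μ ⊗ ζ).withDensity (f·χ)` with
`f = 1_{Ĝ_s}·ρ_sf` (the small-field weight of the good class on the forward-saturated local all-tests-pass set) and
`χ = ∏ kept co-tests`.  Dilation = `T4ShellMeasurePolar.dilate` on `E`, parametrically in `z ∈ Z`.  Binders:
(Det) the tested variable `u_s` depends on the configuration only through `E` and is continuous there (reading of
(2.16)/(1.20)); (FI) `Ĝ_s` and the kept co-tests are forward-invariant along every contraction ray (§3 gives the three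
kernel KINDS); (LR) the reach of the chart on the local small-field set is `x₀ ≤ C_j·ε_j` with `C_j ≤ c₀·R_j`,
`c₀ = c·L·M₂` (KIND printed: the axial-gauge potential on a cube is linear in its side, [Balaban1985Averaging] (47));
(DC-loc) `r ↦ ρ_sf(e^{−r}ŷ, z)·(chart Jacobian)` is forward log-Lipschitz on the window with rate `B_f`, so the polar
density has rate `B = n_loc + B_f` (`T4ShellMeasurePolar.fibreAlternative_polarDensity`) — printed TYPE (B14 Thms 1–3,
(2.23)), instance NOT PRINTED; (MR) `Mw·μ′(E × Z) ≤ M·Σ_τ A τ` — the dropped co-tests fail with relative `μ′`-mass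
`≤ q` each, `m·q ≤ 1/2` (§5: `M = 2`), and `μ′` with ALL co-tests re-inserted is the good term's own weight — PLACED
IN KIND by §8 (v2): (MR-m) the count is polylog, `m ≤ c₃(log g_j⁻²)ⁿ` (the dropped co-tests straddle the boundary of
a cube of side `O(R_j)`, (2.5)), (MR-q) each fraction is of the printed small-factor KIND `q ≤ exp(−c·p₀(g_j))`
(B16 (1.89), tree `Step.FundIneq189`; `p₀(g) = p0Profile A₀ p₀ g`), and `c₃(log g⁻²)ⁿ·exp(−c·p₀(g)) ≤ 1/2` below
ONE `g₁(c₃, n, c, A₀, p₀)` — what stays a binder is `c₃`, `n`, `c` and the relative-mass READING of (1.89); (AN) /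
(AN-bound) (G-ne7cp1-14) for the local chart — the flat point is the centre (`h_p(0) = 0`: at `0` the block is flat
and the localized minimiser of flat data is flat, reading of (2.12)–(2.16)) and the majorant / threshold carry the
same unit factor; (SM) = `T4ShellMeasureSMPlacement.SMPlacement` with the local reach coefficients — DISCHARGED IN
KIND on branch (A) by §4; (W1) (G-ne7cp1-4), (F∞)-rate: unchanged.  GONE for this member: the toron band of the global
chart (`T4ShellMeasureToron`), the interface flips (D11), the cap/floor fork (`T4ShellMeasureSMPlacement` §3 (B)/(C)).

WHAT THIS LEAF DOES (kernel-checked, [folklore], 0 sorry).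
* §1 `withDensity_prod_apply_eq_lintegral`, `slotAntiConcentration_of_sections`: (M1) for `(μ ⊗ ζ).withDensity f`
  from (M1) with the same constant on every `z`-section (Tonelli; `μ`, `ζ` s-finite, `f`, `u` measurable).
* §2 `slotAntiConcentration_local`: `T4ShellMeasurePolar.slotAntiConcentration_withDensity` on the block, section by
  section ⇒ `SlotAntiConcentration ((μ ⊗ ζ).withDensity f) u θ ρ (2·fibreCoef δ B ℓ₀ L)` from the per-fibre
  alternative on every ray of every section — NO multiplicity, NO presentation binder.
* §3 kept co-tests: `fibreAlternative_mul_of_monotone` (a factor non-decreasing along the fibre preserves the per-fibre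
  alternative with the SAME `(δ, s, B, L)` — `FwdLogLipschitzOn.mul` + `of_monotoneOn`, cost `0`),
  `fibreAlternative_congr`, `monotone_indicator_of_fwdInvariant`, `lt_of_twoSidedBelow_of_le` /
  `monotone_indicator_lt_of_twoSidedBelow` (a `TwoSidedBelow` log-variable with defect `≤ 1` passes every sub-onset
  test for ever once it passes), `antitone_norm_dilate` / `monotone_indicator_norm_lt` (norm-ball fluctuation tests), `fwdSaturate` /
  `smul_mem_fwdSaturate` / `monotone_indicator_fwdSaturate` / `isOpen_fwdSaturate` (the forward saturation of a set of
  block configurations is forward-invariant, and open if the set is), `fibreAlternative_polarDensity_mul` (the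
  configuration-space form).
* §4 local reach ⇒ branch (A): `polylogEnvelope_of_localReach` (`C_j ≤ c₀R_j` + `B14.IsRj L r (g j) (R j)` +
  `1 ≤ log g_j⁻²` ⇒ `C_j² ≤ (c₀L)²(log g_j⁻²)^{2r}`, via `B14FlowStep.isRj_le_mul_logpow`), `smPlacement_of_localReach`
  (⇒ `SMPlacement` for couplings in `(0, g₀]`, `g₀ ≤ 1/2` the `T4ShellMeasureSMPlacement` §1 threshold for
  `M = (c₀L)²A₀`, `n = 2r + p₀`), `exists_threshold_smPlacement_local` (ONE `g₀(c₀, L, A₀, r, p₀, κs)` for all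
  windows), `sm_local_of_inInterval` (over a `Flow` of the tree from `Flow.InInterval F γ K`, `γ ≤ g₀`, and the
  (2.5)-sizes hypothesis `hR` literally as in `B14FlowStep`, conclusion with `epsK A₀ p₀ F j`),
  `polylogEnvelope_of_alphaReach` (the variant with the reach read against `α_{1,j}` = `B14.alphaJ`: exponent `2q₁`,
  no (2.5) needed).  Contrast, same (2.5): `T4ShellMeasureSMPlacement.not_smPlacement_of_isRj` (global chart).
* §5 `measure_univ_le_two_mul_of_unionBound`: finitely many dropped co-tests, each failing on relative `μ′`-mass
  `≤ q`, `card·q ≤ 1/2` ⇒ `μ′(everything) ≤ 2·μ′(all pass)`.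
* §6 `slot_field_of_massRatio` ((M1) + shell domination + mass comparison ⇒ the slot field, =
  `T4ShellMeasure.slot_field_of_antiConcentration` BY NAME on rescaled weights), `slot_field_of_localDilation` (the
  member end to end: `Σ_τ piece τ ≤ (2·fibreCoef δ B ℓ₀ L·M·ρ)·Σ_τ A τ` — the shape of the `slot` field of
  `T4ShellMeasureLevels.LevelLedger` for this slot, `D_s = 2·fibreCoef·M`, no multiplicity),
  `slot_field_of_localDilation_sized` (at the admissible window of `T4ShellMeasureAnalytic` §9, `B·ℓ₀ ≤ (1−δ)/2`:
  `D_s ≤ (4e²/(1−δ))·B·M`, LINEAR in the local rate `B = n_loc + B_f` — `fibreCoef_window_le`, `window_admissible`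
  BY NAME).
* §7 non-vacuity: the §4 placement fires on explicit numbers; the kept-neighbour monotonicity fires on the exact
  linear model `TwoSidedBelow.of_linear`; the union bound fires on a two-point space.
* §8 (v2) (MR) placed in kind: `tendsto_logpow_mul_exp_neg_mul_log` (`(log (x²)⁻¹)ⁿ·exp(−b·log (x²)⁻¹) → 0` at
  `0⁺`, Mathlib's `tⁿe^{−t} → 0`), `exp_neg_p0Profile_le_exp_neg_mul_log` (the small factor under its linear-exponent
  majorant on the window `log (x²)⁻¹ ≥ 1`), `exists_threshold_count_smallFactor` (ONE `g₁ ∈ (0, 1/2]` with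
  `M·(log (x²)⁻¹)ⁿ·exp(−c·p0Profile A₀ p₀ x) ≤ 1/2` on `(0, g₁]`), `count_polylog_of_isRj` (`m ≤ c₃R^ν` + (2.5) ⇒
  `m ≤ c₃L^ν(log g⁻²)^{rν}`), `fail_le_smallFactor_of_fundIneq189` (a failure fraction read through tree
  `Step.FundIneq189` is `≤ exp(−2(1+β₀)⁻¹p₀(g))`), `massRatio_two_of_smallFactor` / `exists_threshold_massRatio` (below
  `g₁`: polylog count × small-factor fractions ⇒ `μ′(everything) ≤ 2·μ′(all pass)`), `exists_threshold_joint` (ONE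
  threshold serving §4's (SM) placement AND §8's budget), `mass_le_two_mul_of_unionBound` +
  `slot_field_of_localDilation_placed` (the member end to end with `M = 2`: `D_s = (8e²/(1−δ))·B`); two toys.

WHAT IT DOES NOT DO.  No instance of (Det), (FI), (LR), (DC-loc), (MR), (AN-inst) for Bałaban's objects is constructed
(none of them is formalised; (DC-loc) is not printed as a lemma); the constants `c₀`, `A₀`, `κ`, `h`, `R` of the
placement remain readings of undisplayed printed `O(1)`'s; so do (v2) the count constant/exponent `c₃`, `n` of (MR-m)
and the constant `c` and relative-mass READING of (1.89) of (MR-q) — (1.89) is printed for the 𝐓-operation of a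
large-field region, its use as a bound on the conditional failure fraction of a boundary-straddling co-test under the
block × frozen-exterior law is a READING, entered as the hypothesis `hfail`; the admissible-width clause
`ρ_j·B_j ≤ (1−δ)/4` of the sized form is ledger-level (record §4).  NOT summit progress.

PRINTED LOCI READ FOR THIS LEAF (renders read as page images by this seat, gen 11: B14 p.256
`b2b-balaban-adv8-g40/renders/b14-p256-14.png`, p.257 `b2b-balaban-adv3/g9/b14-p257-top.png`; B15 p.177
`b2b-balaban-adv4/b15-p177.png`, p.180 `b2b-balaban-adv4/b15-p180.png`, p.181 `b2b-balaban-adv4/b15-p181.png`; B16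
p.387 `b2b-balaban-ref1/pages/1989-cmp122-large-field-II/1989-cmp122-large-field-II-p033-x2.png` (v2); loci
already verbatim in tree docstrings are cited BY NAME: `B14.IsRj` (2.5), `B14.alphaJ` (2.28), the header of
`T4AxialChain` for [Balaban1985Averaging] — quoted as LOCI of the KINDS (locality, cube sizes, linear axial potential,
small factor); none is cited as authority for a disputed step):
* [Balaban1988Convergent] = B14 (CMP 119:243–285; journal page = PDF + 242) p.256 [PDF 14]: «The domains Ω_j, Λ_j, which
  are determined by he j-th renormalization transformation, but not by the R-operation, are unions of MR_j-cubes in the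
  lattice T_{L^{−j}}. They satisfy also other conditions, e.g., the distance between their boundaries is at least equal
  to 2MR_j» [sic «he»]; «we assume that the field V_{j−1} is regular on Γ_{j−1} in the sense that |∂V_{j−1} − 1|
  < O(L²)ε_{j−1}»; «In constructions of this and subsequent sections and papers we will have to localize gauge field
  configurations, especially solutions of the variational problems»; p.257 [PDF 15]: «We consider the partition of the
  lattice T_η into LM₂R_k-cubes, compatible with the other partitions, and for each cube □ of this partition we define
  the function U_{k,□}(V_k) by», (2.16) «U_{k,□}(V_k) = U(𝐁_k(□^{∼4}), M˙(Q_k^{s*}V_k))» (record §1.1) — the reading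
  (Det); p.255 (2.5) «R_j is the smallest number of the form Lʳ such, that R_j ≥ (log g_j⁻²)ʳ.» (= `B14.IsRj`); p.259
  (2.28) (= `B14.alphaJ`).
* [Balaban1989LargeFieldI] = B15 (CMP 122:175–202; journal page = PDF + 174) p.177 [PDF 3]: «we take the parts localized
  in neighborhoods of the domains Z′, so they do not depend on the large field regions Z″, and they are determined by
  small field effective actions only»; «(i) it is contained in a cube of the size 100MR_k»; p.180 [PDF 6]: «We need also
  a sequence of determining sets, and the corresponding sequence of functions, localized in the region Z.»
  ((1.19)–(1.20)); p.181 [PDF 7]: «we introduce at first new characteristic functions in such a way that the function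
  restricting the fluctuation field does not depend on the background field», (1.22) «χ_k^{(0)} = χ({|U^{(0)}_{k,Z}(∂p)
  − 1| < (1 − β½)ε_h(L^{k−h}η)² for p ∈ Ω_h∖Ω_{h+1}})» (record §1.4: the threshold ladder whose consecutive rungs bound
  the shells); p.193 [PDF 19] (record §1.5): «This condition is enough to get the exponential small factor, estimating
  in the usual way the Wilson action. Thus 1 − χ_{k,Λ} is a large field function» — the KIND of (MR)'s per-test
  fraction.
* [Balaban1985Averaging] (CMP 98) pp.24–25 (44)–(47), verbatim in the header of `T4AxialChain` (another seat's leaf;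
  cited BY NAME, not imported): in the local axial gauge with initial point y, «|V₀,b − 1| < |b₋ − y|α₀ ≦ dLα₀, hence
  V₀,b = e^{iA_b} and |A_b| < 2|b₋ − y|α₀ ≦ 2dLα₀» — the axial-gauge potential of a small-curvature configuration on a
  cube is LINEAR in the side: the KIND of (LR).
* [Balaban1989LargeFieldII] = B16 (CMP 122:355–392; journal page = PDF + 354) p.384 (quoted in
  `T4ShellMeasureSMPlacement`): the cap depth «N = R_j» — the window on which §4 must and does hold; p.387 [PDF 33]
  (v2, read on the render): «κ_k(X) ≧ 0, and we have the fundamental inequality 𝐓′_k(X)1 ≦ exp(−2(1 + β₀)⁻¹p₀(g_k)).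
  (1.89)», «Next, we have noticed already that the inequality (1.79) holds for the 𝐓-operation connected with an
  arbitrary large field region. The inequality (1.80) holds quite generally for such regions, hence also an improved
  bound (1.89), with the additional term −κ₁d_k(X) in the exponential.», and of (1.88) «for p₀ large and γ small
  enough.» — the printed KIND of the per-test failure fraction (MR-q) (typed in tree `Step.FundIneq189`, whose
  docstring quotes the same display; `p₀(g)` = (2.4) = `Setup.p0Profile`, B15 (0.1) p.175 =
  `Step.exp_neg_p0Profile_eq_rpow`), quoted as LOCUS of the KIND, not as authority for the reading.

ABSOLUTE RULE.  No internally-minted statement is a cited fact; every hypothesis is a binder; nothing of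
[Balaban 1983–89] is instantiated or quoted as authority for a disputed step; all docstrings [folklore]; 0 sorry.
-/

open MeasureTheory Set Metric Filter Topology
open scoped NNReal ENNReal

namespace Literature.MathematicalPhysics.QuantumFieldTheory.Balaban1983to89.T4ShellMeasureLocal

open T4ShellMeasure T4ShellMeasureFibre T4ShellMeasureAnalytic T4ShellMeasurePolar T4ShellMeasureSMPlacement
open B14FlowStep (log_inv_sq_nonneg log_inv_sq_mono isRj_le_mul_logpow)

/-! ## §1  (M1) integrates over a frozen exterior -/

section Sections

variable {X Z : Type*} [MeasurableSpace X] [MeasurableSpace Z]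

/-- The mass a product-with-density measure `(μ ⊗ ζ).withDensity f` gives to a measurable set is the `ζ`-integral
of the masses its SECTIONS `(μ.withDensity f(·, z))` give to the sections of the set (Tonelli). [folklore] -/
theorem withDensity_prod_apply_eq_lintegral (μ : Measure X) [SFinite μ] (ζ : Measure Z) [SFinite ζ]
    {f : X × Z → ℝ≥0∞} (hf : Measurable f) {A : Set (X × Z)} (hA : MeasurableSet A) :
    (μ.prod ζ).withDensity f A = ∫⁻ z, (μ.withDensity fun x => f (x, z)) {x | (x, z) ∈ A} ∂ζ := by
  rw [withDensity_apply _ hA, ← lintegral_indicator hA,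
    lintegral_prod_symm _ (hf.indicator hA).aemeasurable]
  refine lintegral_congr fun z => ?_
  have hAz : MeasurableSet {x | (x, z) ∈ A} := measurable_prodMk_right hA
  rw [withDensity_apply _ hAz, ← lintegral_indicator hAz]
  refine lintegral_congr fun x => ?_
  by_cases hx : (x, z) ∈ A
  · rw [indicator_of_mem hx, indicator_of_mem (show x ∈ {x | (x, z) ∈ A} from hx)]
  · rw [indicator_of_notMem hx, indicator_of_notMem (show x ∉ {x | (x, z) ∈ A} from hx)]

/-- **(M1) INTEGRATES OVER A FROZEN EXTERIOR.**  If every section `z ↦ (μ.withDensity f(·, z), u(·, z))` of a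
product-with-density law satisfies the anti-concentration inequality (M1) at `(θ, ρ)` with the SAME constant `D`,
then so does the law itself: `(M1)` is linear in the measure, so it integrates over any frozen parameter.  This is
what lets the LOCAL member dilate only the slot's own block of variables and freeze everything else. [folklore] -/
theorem slotAntiConcentration_of_sections (μ : Measure X) [SFinite μ] (ζ : Measure Z) [SFinite ζ]
    {f : X × Z → ℝ≥0∞} (hf : Measurable f) {u : X × Z → ℝ} (hu : Measurable u) {θ ρ D : ℝ}
    (h : ∀ z, SlotAntiConcentration (μ.withDensity fun x => f (x, z)) (fun x => u (x, z)) θ ρ D) :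
    SlotAntiConcentration ((μ.prod ζ).withDensity f) u θ ρ D := by
  have hS : MeasurableSet {p : X × Z | θ * (1 - ρ) ≤ u p ∧ u p < θ} :=
    (measurableSet_le measurable_const hu).inter (measurableSet_lt hu measurable_const)
  unfold SlotAntiConcentration
  rw [withDensity_prod_apply_eq_lintegral μ ζ hf hS, withDensity_prod_apply_eq_lintegral μ ζ hf MeasurableSet.univ]
  calc ∫⁻ z, (μ.withDensity fun x => f (x, z)) {x | (x, z) ∈ {p : X × Z | θ * (1 - ρ) ≤ u p ∧ u p < θ}} ∂ζ
      ≤ ∫⁻ z, ENNReal.ofReal (D * ρ) * (μ.withDensity fun x => f (x, z)) univ ∂ζ :=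
        lintegral_mono fun z => h z
    _ = ENNReal.ofReal (D * ρ) * ∫⁻ z, (μ.withDensity fun x => f (x, z)) {x | (x, z) ∈ (univ : Set (X × Z))} ∂ζ := by
        rw [lintegral_const_mul' _ _ ENNReal.ofReal_ne_top]
        simp

end Sections

/-! ## §2  The local presentation: the Polar leaf on the slot's block, parametrically in the exterior -/

section Local

variable {E : Type*} [NormedAddCommGroup E] [NormedSpace ℝ E] [MeasurableSpace E] [BorelSpace E]
  [FiniteDimensional ℝ E] [Nontrivial E] (μ : Measure E) [μ.IsAddHaarMeasure]
  {Z : Type*} [MeasurableSpace Z] (ζ : Measure Z) [SFinite ζ]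

/-- **THE LOCAL MEMBER (γ_loc), ANTI-CONCENTRATION.**  Configuration space = (the slot's finite-dimensional block
`E`, Lebesgue) × (a frozen exterior `Z`, any s-finite law), single-run law `((μ ⊗ ζ).withDensity f)`; the block is
contracted towards its flat point `0` (`T4ShellMeasurePolar.dilate`, log-polar chart), the exterior is NOT moved.
If on every contraction line of every section the per-fibre alternative of `T4ShellMeasureAnalytic` holds for the
polar density, then (M1) holds with `D = 2·fibreCoef δ B ℓ₀ L` — ONE window, NO multiplicity, whatever the exterior.
[folklore] -/
theorem slotAntiConcentration_local {f : E × Z → ℝ≥0∞} (hf : Measurable f) {u : E × Z → ℝ}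
    (hu : Measurable u) {δ s B θ ρ ℓ₀ L : ℝ} (hδ0 : 0 ≤ δ) (hδ1 : δ < 1) (hB : 0 ≤ B) (hθ : 0 < θ)
    (hθs : θ ≤ s) (hρ0 : 0 ≤ ρ) (hρ2 : ρ ≤ 1 / 2) (hℓ₀ : -Real.log (1 - ρ) ≤ ℓ₀)
    (hlam : 0 < L / (1 + δ) - ℓ₀ / (1 - δ))
    (hfib : ∀ z, ∀ y : E, ‖y‖ = 1 →
      FibreAlternative (polarDensity (Module.finrank ℝ E) fun x => f (x, z)) ((fun x => u (x, z)) ∘ dilate)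
        δ s B θ ρ L y) :
    SlotAntiConcentration ((μ.prod ζ).withDensity f) u θ ρ (2 * fibreCoef δ B ℓ₀ L) :=
  slotAntiConcentration_of_sections μ ζ hf hu fun z =>
    slotAntiConcentration_withDensity μ (hf.comp measurable_prodMk_right) (hu.comp measurable_prodMk_right)
      hδ0 hδ1 hB hθ hθs hρ0 hρ2 hℓ₀ hlam (hfib z)

end Local

/-! ## §3  Kept co-tests: factors non-decreasing along the contraction ride inside the dilated density for free -/

section CoTests

variable {Y : Type*}

/-- the per-fibre alternative depends on the fibre density only THROUGH its values on the fibre. [folklore] -/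
theorem fibreAlternative_congr {F G : Y × ℝ → ℝ≥0∞} {u : Y × ℝ → ℝ} {δ s B θ ρ L : ℝ} {y : Y}
    (hFG : ∀ r, F (y, r) = G (y, r)) (h : FibreAlternative F u δ s B θ ρ L y) :
    FibreAlternative G u δ s B θ ρ L y := by
  have e : (fun r => G (y, r)) = fun r => F (y, r) := funext fun r => (hFG r).symm
  rcases h with h0 | ⟨v, hvm, hvpos, hincl, hts, hdc⟩
  · exact Or.inl fun r hr => (hFG r) ▸ h0 r hr
  · refine Or.inr ⟨v, hvm, hvpos, fun r hr => (hincl r hr).imp (fun h0 => (hFG r) ▸ h0) id, hts, ?_⟩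
    rw [e]; exact hdc

/-- **A KEPT CO-TEST COSTS NOTHING.**  Multiplying the fibre density by a factor `χ` that is NON-DECREASING along the
fibre (forward = towards smaller local fields) preserves the per-fibre alternative with the SAME `(δ, s, B, L)`:
same exceptional fibres, same proxy, forward log-Lipschitz constant `B + 0` (`FwdLogLipschitzOn.mul`,
`FwdLogLipschitzOn.of_monotoneOn`).  So indicators of FORWARD-INVARIANT events stay INSIDE the dilated density —
no interface flip, no shell-domination residual for them. [folklore] -/
theorem fibreAlternative_mul_of_monotone {F χ : Y × ℝ → ℝ≥0∞} {u : Y × ℝ → ℝ} {δ s B θ ρ L : ℝ} {y : Y}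
    (h : FibreAlternative F u δ s B θ ρ L y) (hχ : Monotone fun r => χ (y, r)) :
    FibreAlternative (fun p => F p * χ p) u δ s B θ ρ L y := by
  rcases h with h0 | ⟨v, hvm, hvpos, hincl, hts, hdc⟩
  · exact Or.inl fun r hr => show F (y, r) * χ (y, r) = 0 by rw [h0 r hr, zero_mul]
  · refine Or.inr ⟨v, hvm, hvpos, fun r hr =>
      (hincl r hr).imp (fun h0 => show F (y, r) * χ (y, r) = 0 by rw [h0, zero_mul]) id, hts, ?_⟩
    have h1 := hdc.mul (FwdLogLipschitzOn.of_monotoneOn (hχ.monotoneOn _))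
    rwa [add_zero] at h1

/-- the indicator of a FORWARD-INVARIANT event (once in, in for ever along the contraction) is non-decreasing along
the fibre. [folklore] -/
theorem monotone_indicator_of_fwdInvariant {S : Set (Y × ℝ)} {y : Y}
    (hS : ∀ ⦃r r' : ℝ⦄, r ≤ r' → (y, r) ∈ S → (y, r') ∈ S) (c : ℝ≥0∞) :
    Monotone fun r => S.indicator (fun _ => c) (y, r) := by
  intro r r' hrr'
  by_cases hr : (y, r) ∈ S
  · simp only [indicator_of_mem hr, indicator_of_mem (hS hrr' hr), le_refl]
  · simp only [indicator_of_notMem hr, zero_le]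

/-- **KEPT NEIGHBOURS.**  A neighbouring slot whose log-tested-variable `g` is TWO-SIDED below the onset `c` with
defect `δ ≤ 1` along the contraction (`T4ShellMeasureFibre.TwoSidedBelow` — the located (AN)-rate, shape of
`T4ShellMeasureAnalytic` §6) PASSES FOR EVER once it passes: every sub-onset pass event `{g < b}`, `b ≤ c`, is
forward-invariant.  This is what makes the co-tests of FULLY COVERED neighbouring slots KEPT co-tests (no interface
flip — the dead end D11 of the record is dissolved, not dodged). [folklore] -/
theorem lt_of_twoSidedBelow_of_le {g : ℝ → ℝ} {δ c b : ℝ} (h : TwoSidedBelow g δ c) (hδ : δ ≤ 1) (hb : b ≤ c)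
    ⦃r r' : ℝ⦄ (hrr' : r ≤ r') (hr : g r < b) : g r' < b := by
  have h1 := (h hrr' (hr.trans_le hb)).1
  nlinarith

/-- the pass indicator of a kept neighbour is non-decreasing along the fibre. [folklore] -/
theorem monotone_indicator_lt_of_twoSidedBelow {g : ℝ → ℝ} {δ c b : ℝ} (h : TwoSidedBelow g δ c) (hδ : δ ≤ 1)
    (hb : b ≤ c) (w : ℝ≥0∞) : Monotone fun r => {r : ℝ | g r < b}.indicator (fun _ => w) r := by
  intro r r' hrr'
  by_cases hr : g r < b
  · have hr' : g r' < b := lt_of_twoSidedBelow_of_le h hδ hb hrr' hr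
    simp only [mem_setOf_eq, hr, hr', indicator_of_mem, le_refl]
  · simp only [mem_setOf_eq, hr, not_false_eq_true, indicator_of_notMem, zero_le]

variable {E : Type*} [NormedAddCommGroup E] [NormedSpace ℝ E]

/-- **KEPT FLUCTUATION TESTS.**  A small-field bound on the block's fluctuation variables of the form `N x < p` with
`N` absolutely homogeneous of degree one (a norm, a seminorm, a sup of moduli of components) is forward-invariant
under the contraction `x ↦ e^{−r} x`: here for the ambient norm. [folklore] -/
theorem antitone_norm_dilate (y : E) : Antitone fun r : ℝ => ‖Real.exp (-r) • y‖ := by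
  intro r r' hrr'
  dsimp only
  rw [norm_smul, norm_smul, Real.norm_of_nonneg (Real.exp_pos _).le, Real.norm_of_nonneg (Real.exp_pos _).le]
  exact mul_le_mul_of_nonneg_right (Real.exp_le_exp.2 (neg_le_neg hrr')) (norm_nonneg _)

/-- the pass indicator of a norm-ball fluctuation test is non-decreasing along the fibre. [folklore] -/
theorem monotone_indicator_norm_lt (y : E) (p : ℝ) (w : ℝ≥0∞) :
    Monotone fun r : ℝ => {x : E | ‖x‖ < p}.indicator (fun _ => w) (Real.exp (-r) • y) := by
  intro r r' hrr'
  by_cases hr : ‖Real.exp (-r) • y‖ < p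
  · have hr' : ‖Real.exp (-r') • y‖ < p := (antitone_norm_dilate y hrr').trans_lt hr
    simp only [mem_setOf_eq, hr, hr', indicator_of_mem, le_refl]
  · simp only [mem_setOf_eq, hr, not_false_eq_true, indicator_of_notMem, zero_le]

/-- THE FORWARD SATURATION of a set of block configurations along the contraction: all contracted copies `e^{−r}·x`,
`r ≥ 0`, of its points (the reading (FI-sat) saturates the local all-tests-pass set this way). [folklore] -/
def fwdSaturate (S : Set E) : Set E := {x | ∃ r : ℝ, 0 ≤ r ∧ Real.exp r • x ∈ S}

/-- the saturation contains the set. [folklore] -/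
theorem subset_fwdSaturate (S : Set E) : S ⊆ fwdSaturate S :=
  fun x hx => ⟨0, le_rfl, by simpa using hx⟩

/-- the saturation is FORWARD-INVARIANT: contracting a point of it keeps it inside. [folklore] -/
theorem smul_mem_fwdSaturate {S : Set E} {x : E} (hx : x ∈ fwdSaturate S) {t : ℝ} (ht : 0 ≤ t) :
    Real.exp (-t) • x ∈ fwdSaturate S := by
  obtain ⟨r, hr, hrS⟩ := hx
  refine ⟨r + t, by positivity, ?_⟩
  rwa [smul_smul, ← Real.exp_add, show r + t + -t = r by ring]

/-- hence its indicator is a KEPT co-test: non-decreasing along every contraction ray. [folklore] -/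
theorem monotone_indicator_fwdSaturate (S : Set E) (y : E) (w : ℝ≥0∞) :
    Monotone fun r : ℝ => (fwdSaturate S).indicator (fun _ => w) (Real.exp (-r) • y) := by
  intro r r' hrr'
  by_cases hr : Real.exp (-r) • y ∈ fwdSaturate S
  · have hr' : Real.exp (-r') • y ∈ fwdSaturate S := by
      have h := smul_mem_fwdSaturate hr (sub_nonneg.2 hrr')
      rwa [smul_smul, ← Real.exp_add, show -(r' - r) + -r = -r' by ring] at h
    simp only [hr, hr', indicator_of_mem, le_refl]
  · simp only [hr, not_false_eq_true, indicator_of_notMem, zero_le]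

/-- the saturation of an OPEN set (a finite intersection of strict small-field conditions on continuous tested
variables) is open, hence Borel: `⋃_{r ≥ 0} (e^{r}·)⁻¹ S`. [folklore] -/
theorem isOpen_fwdSaturate {S : Set E} (hS : IsOpen S) : IsOpen (fwdSaturate S) := by
  have e : fwdSaturate S = ⋃ r ∈ Ici (0 : ℝ), (fun x : E => Real.exp r • x) ⁻¹' S := by
    ext x
    simp only [fwdSaturate, mem_setOf_eq, mem_iUnion, mem_Ici, mem_preimage, exists_prop]
  rw [e]
  exact isOpen_biUnion fun r _ => hS.preimage (continuous_const_smul (Real.exp r))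

/-- [folklore] -/
theorem measurableSet_fwdSaturate [MeasurableSpace E] [OpensMeasurableSpace E] {S : Set E} (hS : IsOpen S) :
    MeasurableSet (fwdSaturate S) :=
  (isOpen_fwdSaturate hS).measurableSet

/-- **POLAR FORM.**  On the configuration space: if the per-fibre alternative holds for the log-polar density of `f`
on the unit direction `ŷ`, and the co-test `χ` is non-decreasing along the ray `r ↦ e^{−r} ŷ`, it holds for the
log-polar density of `f·χ` with the same constants. [folklore] -/
theorem fibreAlternative_polarDensity_mul {n : ℝ} {f χ : E → ℝ≥0∞} {u : E → ℝ} {δ s B θ ρ L : ℝ} {y : E}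
    (hy : ‖y‖ = 1) (h : FibreAlternative (polarDensity n f) (u ∘ dilate) δ s B θ ρ L y)
    (hχ : Monotone fun r : ℝ => χ (Real.exp (-r) • y)) :
    FibreAlternative (polarDensity n fun x => f x * χ x) (u ∘ dilate) δ s B θ ρ L y := by
  refine fibreAlternative_congr (fun r => ?_)
    (fibreAlternative_mul_of_monotone (χ := fun p : E × ℝ => χ (Real.exp (-p.2) • p.1)) h hχ)
  simp only [polarDensity_of_norm_eq_one hy, mul_assoc]

end CoTests

/-! ## §4  Local reach: the size of the slot's own localization cube is polylog in the coupling by (2.5), so the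
(SM)/(PL) placement of `T4ShellMeasureSMPlacement` holds on branch (A) at ALL live levels -/

section LocalReach

/-- **(LR) + (2.5) ⇒ POLYLOG ENVELOPE, EXPONENT `2r`.**  If the reach coefficient of level `j` is at most `c₀·R_j`
(the reading (LR): an axial chart on the slot's OWN localization cube, whose linear size is a fixed multiple of
`R_j` — B14 p.257 (2.16): cubes of size `L M₂ R_k`; B15 p.177 (i): components in a cube of size `100 M R_k`), and
`R_j` is print's (2.5) (`B14.IsRj`: the least power of `L` above `(log g_j⁻²)^r`, so `R_j ≤ L·(log g_j⁻²)^r` by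
`B14FlowStep.isRj_le_mul_logpow`), then `C_j² ≤ (c₀L)²·(log g_j⁻²)^{2r}`: the polylog envelope of
`T4ShellMeasureSMPlacement.smPlacement_of_polylogEnvelope` with `E₀ = (c₀L)²`, `q = 2r`. [folklore] -/
theorem polylogEnvelope_of_localReach {W : Set ℕ} {C g : ℕ → ℝ} {R : ℕ → ℕ} {c₀ : ℝ} {L r : ℕ}
    (hL : 1 ≤ L) (hR : ∀ j ∈ W, B14.IsRj L r (g j) (R j)) (hlog : ∀ j ∈ W, 1 ≤ Real.log (g j ^ 2)⁻¹)
    (hC : ∀ j ∈ W, 0 ≤ C j ∧ C j ≤ c₀ * R j) :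
    ∀ j ∈ W, C j ^ 2 ≤ (c₀ * L) ^ 2 * (Real.log (g j ^ 2)⁻¹) ^ (2 * r) := by
  intro j hj
  obtain ⟨hC0, hCle⟩ := hC j hj
  have hP1 : 1 ≤ (Real.log (g j ^ 2)⁻¹) ^ r := one_le_pow₀ (hlog j hj)
  have hRle : (R j : ℝ) ≤ L * (Real.log (g j ^ 2)⁻¹) ^ r := isRj_le_mul_logpow hL (hR j hj) hP1
  have hR0 : (0 : ℝ) ≤ R j := Nat.cast_nonneg _
  have hc₀ : 0 ≤ c₀ ∨ (R j : ℝ) = 0 := by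
    rcases eq_or_lt_of_le hR0 with h0 | hpos
    · exact Or.inr h0.symm
    · exact Or.inl (nonneg_of_mul_nonneg_left (hC0.trans hCle) hpos)
  have h1 : C j ≤ c₀ * L * (Real.log (g j ^ 2)⁻¹) ^ r := by
    rcases hc₀ with hc₀ | h0
    · calc C j ≤ c₀ * R j := hCle
        _ ≤ c₀ * (L * (Real.log (g j ^ 2)⁻¹) ^ r) := mul_le_mul_of_nonneg_left hRle hc₀
        _ = c₀ * L * (Real.log (g j ^ 2)⁻¹) ^ r := by ring
    · exfalso
      obtain ⟨_, _, hle, _⟩ := hR j hj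
      have : (1 : ℝ) ≤ 0 := by
        calc (1 : ℝ) ≤ (Real.log (g j ^ 2)⁻¹) ^ r := hP1
          _ ≤ R j := hle
          _ = 0 := h0
      linarith
  calc C j ^ 2 ≤ (c₀ * L * (Real.log (g j ^ 2)⁻¹) ^ r) ^ 2 := pow_le_pow_left₀ hC0 h1 2
    _ = (c₀ * L) ^ 2 * (Real.log (g j ^ 2)⁻¹) ^ (2 * r) := by ring

/-- **(PL) FOR THE LOCAL CHART ON BRANCH (A), AT ALL LIVE LEVELS.**  Under (LR) and print's (2.5) the placement
`SMPlacement W C ρ g A₀ κ s p₀` of `T4ShellMeasureSMPlacement` (≡ the (SM) binder of the analytic member on the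
window, `binder_of_placement`) holds for EVERY window whose couplings lie in `(0, g₀]`, `g₀ ≤ 1/2` the §1-threshold
of that leaf for `M = (c₀L)²·A₀`, `n = 2r + p₀`, `c = κs/2` — ONE threshold for all ages.  Contrast, under the SAME
(2.5): for the GLOBAL chart (reach ≥ linear size·θ/4) the placement is FALSE at the oldest live level
(`T4ShellMeasureSMPlacement.not_smPlacement_of_isRj`). [folklore] -/
theorem smPlacement_of_localReach {W : Set ℕ} {C ρ g : ℕ → ℝ} {R : ℕ → ℕ} {A₀ c₀ κ s g₀ : ℝ} {L r p₀ : ℕ}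
    (hL : 1 ≤ L) (hA₀ : 0 ≤ A₀) (hg₀ : g₀ ≤ 1 / 2)
    (hthr : ∀ x, 0 < x → x ≤ g₀ →
      (c₀ * L) ^ 2 * A₀ * (x * (Real.log (x ^ 2)⁻¹) ^ (2 * r + p₀)) ≤ κ * s / 2)
    (hg : ∀ j ∈ W, 0 < g j ∧ g j ≤ g₀) (hR : ∀ j ∈ W, B14.IsRj L r (g j) (R j))
    (hC : ∀ j ∈ W, 0 ≤ C j ∧ C j ≤ c₀ * R j) (hρ : ∀ j ∈ W, ρ j ≤ 1 / 2) (hκs : 0 ≤ κ * s) :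
    SMPlacement W C ρ g A₀ κ s p₀ :=
  have hlog : ∀ j ∈ W, 1 ≤ Real.log (g j ^ 2)⁻¹ := fun j hj =>
    one_le_log_inv_sq_of_le (hg j hj).1 ((hg j hj).2.trans hg₀) one_le_log_four
  smPlacement_of_polylogEnvelope hA₀ (hg₀.trans (by norm_num)) hthr hg
    (polylogEnvelope_of_localReach hL hR hlog hC) hρ hκs

/-- **THE THRESHOLD, PACKAGED.**  For `(c₀, L, A₀, r, p₀)` and `κs > 0` there is ONE `g₀ ∈ (0, 1/2]` such that the
placement holds on every window with couplings in `(0, g₀]`, (2.5)-sizes, local reach `C_j ≤ c₀R_j` and widths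
`ρ_j ≤ 1/2` — the (SM) binder of the shell-measure route DISCHARGED IN KIND on branch (A) for the local member
(constants `c₀`, `A₀`, `κ` remain readings of undisplayed printed `O(1)`'s). [folklore] -/
theorem exists_threshold_smPlacement_local {A₀ c₀ κ s : ℝ} {L : ℕ} (hL : 1 ≤ L) (hA₀ : 0 ≤ A₀)
    (hκs : 0 < κ * s) (r p₀ : ℕ) :
    ∃ g₀ : ℝ, 0 < g₀ ∧ g₀ ≤ 1 / 2 ∧ ∀ (W : Set ℕ) (C ρ g : ℕ → ℝ) (R : ℕ → ℕ),
      (∀ j ∈ W, 0 < g j ∧ g j ≤ g₀) → (∀ j ∈ W, B14.IsRj L r (g j) (R j)) →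
      (∀ j ∈ W, 0 ≤ C j ∧ C j ≤ c₀ * R j) → (∀ j ∈ W, ρ j ≤ 1 / 2) → SMPlacement W C ρ g A₀ κ s p₀ := by
  obtain ⟨g₀, hg₀, hg₀1, hthr⟩ :=
    exists_threshold_logInvSq_pow ((c₀ * L) ^ 2 * A₀) (κ * s / 2) (by linarith) (2 * r + p₀)
  exact ⟨g₀, hg₀, hg₀1, fun W C ρ g R hg hR hC hρ => smPlacement_of_localReach hL hA₀ hg₀1 hthr hg hR hC hρ hκs.le⟩

/-- **OVER A FLOW OF THE TREE.**  With the couplings read off a `Flow` on a window `{j ≤ K}` inside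
`Flow.InInterval F γ K` (`0 < g_j ≤ γ ≤ g₀`) and the (2.5)-sizes hypothesis `hR` literally as in
`B14FlowStep` (`∀ j ≤ K, B14.IsRj L r (F.g j) (R j)`), the local member's (SM) inequality holds with print's
threshold profile `epsK A₀ p₀ F j = F.g j · p0Profile A₀ p₀ (F.g j)` ((2.4)). [folklore] -/
theorem sm_local_of_inInterval {F : Flow} {γ g₀ A₀ c₀ κ s : ℝ} {K L r p₀ : ℕ} {C ρ : ℕ → ℝ} {R : ℕ → ℕ}
    (hL : 1 ≤ L) (hA₀ : 0 ≤ A₀) (hg₀ : g₀ ≤ 1 / 2)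
    (hthr : ∀ x, 0 < x → x ≤ g₀ →
      (c₀ * L) ^ 2 * A₀ * (x * (Real.log (x ^ 2)⁻¹) ^ (2 * r + p₀)) ≤ κ * s / 2)
    (hF : F.InInterval γ K) (hγ : γ ≤ g₀) (hR : ∀ j ≤ K, B14.IsRj L r (F.g j) (R j))
    (hC : ∀ j ≤ K, 0 ≤ C j ∧ C j ≤ c₀ * R j) (hρ : ∀ j ≤ K, ρ j ≤ 1 / 2) (hκs : 0 ≤ κ * s) :
    ∀ j ≤ K, C j ^ 2 * epsK A₀ p₀ F j ≤ κ * (s * (1 - ρ j)) := by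
  have h : SMPlacement {j | j ≤ K} C ρ F.g A₀ κ s p₀ :=
    smPlacement_of_localReach hL hA₀ hg₀ hthr (fun j hj => ⟨(hF j hj).1, (hF j hj).2.trans hγ⟩)
      (fun j hj => hR j hj) (fun j hj => hC j hj) (fun j hj => hρ j hj) hκs
  intro j hj
  exact h j hj

/-- **THE `α_{1,j}` VARIANT.**  If the local reach is read against print's link-variable domain size
`α_{1,j} = C₁ g_j (log g_j⁻²)^{q₁}` ((2.28), `B14.alphaJ`) in units of the threshold scale `g_j`, i.e.
`C_j ≤ c₀·C₁·(log g_j⁻²)^{q₁}`, the envelope is polylog with exponent `2q₁` directly (no (2.5) needed). [folklore] -/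
theorem polylogEnvelope_of_alphaReach {W : Set ℕ} {C g : ℕ → ℝ} {c₀ C₁ : ℝ} {q₁ : ℕ}
    (hC : ∀ j ∈ W, 0 ≤ C j ∧ C j * g j ≤ c₀ * B14.alphaJ C₁ q₁ (g j)) (hg : ∀ j ∈ W, 0 < g j) :
    ∀ j ∈ W, C j ^ 2 ≤ (c₀ * C₁) ^ 2 * (Real.log (g j ^ 2)⁻¹) ^ (2 * q₁) := by
  intro j hj
  obtain ⟨hC0, hCle⟩ := hC j hj
  have hgj := hg j hj
  have h1 : C j ≤ c₀ * C₁ * (Real.log (g j ^ 2)⁻¹) ^ q₁ := by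
    have h2 : C j * g j ≤ (c₀ * C₁ * (Real.log (g j ^ 2)⁻¹) ^ q₁) * g j := by
      calc C j * g j ≤ c₀ * B14.alphaJ C₁ q₁ (g j) := hCle
        _ = (c₀ * C₁ * (Real.log (g j ^ 2)⁻¹) ^ q₁) * g j := by unfold B14.alphaJ; ring
    exact le_of_mul_le_mul_right h2 hgj
  calc C j ^ 2 ≤ (c₀ * C₁ * (Real.log (g j ^ 2)⁻¹) ^ q₁) ^ 2 := pow_le_pow_left₀ hC0 h1 2
    _ = (c₀ * C₁) ^ 2 * (Real.log (g j ^ 2)⁻¹) ^ (2 * q₁) := by ring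

end LocalReach

/-! ## §5  The mass ratio of the dropped co-tests by a union bound -/

section MassRatio

variable {Ω : Type*} [MeasurableSpace Ω]

/-- **UNION BOUND ⇒ MASS RATIO `2`.**  If each of the finitely many DROPPED co-tests fails, under the dominating
law `μ′`, on a set of relative mass at most `q`, and `(number of dropped co-tests)·q ≤ 1/2`, then
`μ′(everything) ≤ 2·μ′(all dropped co-tests pass)` — the (MR) binder of the local member reduced to a per-test
failure fraction (printed KIND: the large-field small factor, B15 p.193 (1.75)) and a count. [folklore] -/
theorem measure_univ_le_two_mul_of_unionBound (μ' : Measure Ω) [IsFiniteMeasure μ'] {κ : Type*}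
    (I : Finset κ) (Fail : κ → Set Ω) {q : ℝ}
    (hfail : ∀ i ∈ I, μ' (Fail i) ≤ ENNReal.ofReal q * μ' univ) (hm : (I.card : ℝ) * q ≤ 1 / 2) :
    μ' univ ≤ 2 * μ' (⋂ i ∈ I, (Fail i)ᶜ) := by
  have hU : μ' (⋃ i ∈ I, Fail i) ≤ ENNReal.ofReal (1 / 2) * μ' univ := by
    calc μ' (⋃ i ∈ I, Fail i) ≤ ∑ i ∈ I, μ' (Fail i) := measure_biUnion_finset_le I Fail
      _ ≤ ∑ i ∈ I, ENNReal.ofReal q * μ' univ := Finset.sum_le_sum fun i hi => hfail i hi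
      _ = ENNReal.ofReal (I.card * q) * μ' univ := by
          rw [Finset.sum_const, nsmul_eq_mul, ← mul_assoc, ENNReal.ofReal_mul (Nat.cast_nonneg _),
            ENNReal.ofReal_natCast]
      _ ≤ ENNReal.ofReal (1 / 2) * μ' univ := mul_le_mul_of_nonneg_right (ENNReal.ofReal_le_ofReal hm) bot_le
  have hcompl : (⋂ i ∈ I, (Fail i)ᶜ) = (⋃ i ∈ I, Fail i)ᶜ := by
    rw [compl_iUnion₂]
  have hsplit : μ' univ ≤ μ' (⋂ i ∈ I, (Fail i)ᶜ) + μ' (⋃ i ∈ I, Fail i) := by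
    rw [hcompl]
    calc μ' univ = μ' ((⋃ i ∈ I, Fail i)ᶜ ∪ ⋃ i ∈ I, Fail i) := by rw [compl_union_self]
      _ ≤ μ' ((⋃ i ∈ I, Fail i)ᶜ) + μ' (⋃ i ∈ I, Fail i) := measure_union_le _ _
  have hfin : μ' univ ≠ ⊤ := measure_ne_top _ _
  have hhalf : ENNReal.ofReal (1 / 2) * μ' univ + ENNReal.ofReal (1 / 2) * μ' univ = μ' univ := by
    rw [← add_mul, ← ENNReal.ofReal_add (by norm_num) (by norm_num)]; norm_num
  have h1 : μ' univ ≤ μ' (⋂ i ∈ I, (Fail i)ᶜ) + ENNReal.ofReal (1 / 2) * μ' univ :=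
    hsplit.trans (add_le_add le_rfl hU)
  have h2 : ENNReal.ofReal (1 / 2) * μ' univ ≤ μ' (⋂ i ∈ I, (Fail i)ᶜ) := by
    have h3 : ENNReal.ofReal (1 / 2) * μ' univ + ENNReal.ofReal (1 / 2) * μ' univ ≤
        μ' (⋂ i ∈ I, (Fail i)ᶜ) + ENNReal.ofReal (1 / 2) * μ' univ := by rwa [hhalf]
    exact ENNReal.le_of_add_le_add_right (ENNReal.mul_ne_top ENNReal.ofReal_ne_top hfin) h3
  calc μ' univ = 2 * (ENNReal.ofReal (1 / 2) * μ' univ) := by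
        rw [← mul_assoc, show (2 : ℝ≥0∞) = ENNReal.ofReal 2 by norm_num, ← ENNReal.ofReal_mul (by norm_num)]
        norm_num
    _ ≤ 2 * μ' (⋂ i ∈ I, (Fail i)ᶜ) := by gcongr

end MassRatio

/-! ## §6  End-to-end: the local member's slot-ledger field -/

section EndToEnd

/-- **SLOT FIELD WITH A MASS RATIO.**  (M1) for the dominating law `μ′` with constant `D`, the shell pieces of the
slot dominated by `Mw·μ′(shell)`, and the mass comparison `Mw·μ′(everything) ≤ M·Σ_τ A τ` give the slot-ledger
field `Σ_τ piece τ ≤ (D·M·ρ)·Σ_τ A τ` — `T4ShellMeasure.slot_field_of_antiConcentration` BY NAME applied to the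
rescaled weights `M·A`. [folklore] -/
theorem slot_field_of_massRatio {Ω ι : Type*} [MeasurableSpace Ω] {μ' : Measure Ω} [IsFiniteMeasure μ']
    {u : Ω → ℝ} {θ ρ D : ℝ} (hD : 0 ≤ D) (hρ : 0 ≤ ρ) (hac : SlotAntiConcentration μ' u θ ρ D)
    (T : Finset ι) {piece A : ι → ℝ} {Mw M : ℝ} (hMw : 0 ≤ Mw)
    (hpiece : ∑ τ ∈ T, piece τ ≤ Mw * (μ' {x | θ * (1 - ρ) ≤ u x ∧ u x < θ}).toReal)
    (hA : Mw * (μ' univ).toReal ≤ M * ∑ τ ∈ T, A τ) :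
    ∑ τ ∈ T, piece τ ≤ (D * M * ρ) * ∑ τ ∈ T, A τ := by
  have h := slot_field_of_antiConcentration hD hρ hac T hMw hpiece (A := fun τ => M * A τ)
    (by rwa [← Finset.mul_sum])
  rw [← Finset.mul_sum] at h
  calc ∑ τ ∈ T, piece τ ≤ D * ρ * (M * ∑ τ ∈ T, A τ) := h
    _ = (D * M * ρ) * ∑ τ ∈ T, A τ := by ring

variable {E : Type*} [NormedAddCommGroup E] [NormedSpace ℝ E] [MeasurableSpace E] [BorelSpace E]
  [FiniteDimensional ℝ E] [Nontrivial E] (μ : Measure E) [μ.IsAddHaarMeasure]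
  {Z : Type*} [MeasurableSpace Z] (ζ : Measure Z) [SFinite ζ]

/-- **THE LOCAL MEMBER (γ_loc), END TO END.**  Data: the slot's block `E` (finite-dimensional, Lebesgue `μ`) and a
frozen exterior `(Z, ζ)`; the small-field weight part `f` and the KEPT co-tests `χ` of the dominating law
`μ′ = (μ ⊗ ζ).withDensity (f·χ)` (finite); the tested variable `u`; the per-fibre alternative for the log-polar
density of every section of `f` (binders (AN)+(DC-loc)+(SM), the latter placed by §4); the kept co-tests
non-decreasing along every contraction ray (binder (FI), §3); the shell pieces dominated by `Mw·μ′(shell)` (AUTOMATIC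
for this member: the pieces are integrals of sub-products of the same non-negative factors); the mass comparison
`Mw·μ′(everything) ≤ M·Σ_τ A τ` (binder (MR), §5).  Conclusion: the `LevelLedger.slot` field of
`T4ShellMeasureLevels` for this slot with `D_s = 2·fibreCoef δ B ℓ₀ L·M` — NO multiplicity factor. [folklore] -/
theorem slot_field_of_localDilation {ι : Type*} {f χ : E × Z → ℝ≥0∞} (hf : Measurable f) (hχ : Measurable χ)
    [IsFiniteMeasure ((μ.prod ζ).withDensity fun p => f p * χ p)] {u : E × Z → ℝ} (hu : Measurable u)
    {δ s B θ ρ ℓ₀ L : ℝ} (hδ0 : 0 ≤ δ) (hδ1 : δ < 1) (hB : 0 ≤ B) (hθ : 0 < θ) (hθs : θ ≤ s) (hρ0 : 0 ≤ ρ)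
    (hρ2 : ρ ≤ 1 / 2) (hℓ₀ : -Real.log (1 - ρ) ≤ ℓ₀) (hlam : 0 < L / (1 + δ) - ℓ₀ / (1 - δ))
    (hfib : ∀ z, ∀ y : E, ‖y‖ = 1 →
      FibreAlternative (polarDensity (Module.finrank ℝ E) fun x => f (x, z)) ((fun x => u (x, z)) ∘ dilate)
        δ s B θ ρ L y)
    (hmono : ∀ z, ∀ y : E, ‖y‖ = 1 → Monotone fun r : ℝ => χ (Real.exp (-r) • y, z))
    (T : Finset ι) {piece A : ι → ℝ} {Mw M : ℝ} (hMw : 0 ≤ Mw)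
    (hpiece : ∑ τ ∈ T, piece τ ≤
      Mw * (((μ.prod ζ).withDensity fun p => f p * χ p) {p | θ * (1 - ρ) ≤ u p ∧ u p < θ}).toReal)
    (hmass : Mw * (((μ.prod ζ).withDensity fun p => f p * χ p) univ).toReal ≤ M * ∑ τ ∈ T, A τ) :
    ∑ τ ∈ T, piece τ ≤ (2 * fibreCoef δ B ℓ₀ L * M * ρ) * ∑ τ ∈ T, A τ :=
  slot_field_of_massRatio (by unfold fibreCoef; positivity) hρ0
    (slotAntiConcentration_local μ ζ (hf.mul hχ) hu hδ0 hδ1 hB hθ hθs hρ0 hρ2 hℓ₀ hlam fun z y hy =>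
      fibreAlternative_polarDensity_mul hy (hfib z y hy) (hmono z y hy))
    T hMw hpiece hmass

/-- **SIZED BY THE LOCAL PHASE SPACE.**  With the admissible window of `T4ShellMeasureAnalytic` §9
(`L = (1+δ)(ℓ₀/(1−δ) + 1/B)`, admissible when `B·ℓ₀ ≤ (1−δ)/2`) the constant is LINEAR in the local rate
`B = n_loc + B_f`: `D_s ≤ (4e²/(1−δ))·B·M` (`fibreCoef_window_le` BY NAME). [folklore] -/
theorem slot_field_of_localDilation_sized {ι : Type*} {f χ : E × Z → ℝ≥0∞} (hf : Measurable f)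
    (hχ : Measurable χ) [IsFiniteMeasure ((μ.prod ζ).withDensity fun p => f p * χ p)] {u : E × Z → ℝ}
    (hu : Measurable u) {δ s B θ ρ ℓ₀ : ℝ} (hδ0 : 0 ≤ δ) (hδ1 : δ < 1) (hB : 0 < B) (hθ : 0 < θ) (hθs : θ ≤ s)
    (hρ0 : 0 ≤ ρ) (hρ2 : ρ ≤ 1 / 2) (hℓ₀ : -Real.log (1 - ρ) ≤ ℓ₀) (hBℓ : B * ℓ₀ ≤ (1 - δ) / 2)
    (hfib : ∀ z, ∀ y : E, ‖y‖ = 1 →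
      FibreAlternative (polarDensity (Module.finrank ℝ E) fun x => f (x, z)) ((fun x => u (x, z)) ∘ dilate)
        δ s B θ ρ ((1 + δ) * (ℓ₀ / (1 - δ) + 1 / B)) y)
    (hmono : ∀ z, ∀ y : E, ‖y‖ = 1 → Monotone fun r : ℝ => χ (Real.exp (-r) • y, z))
    (T : Finset ι) {piece A : ι → ℝ} {Mw M : ℝ} (hMw : 0 ≤ Mw)
    (hpiece : ∑ τ ∈ T, piece τ ≤
      Mw * (((μ.prod ζ).withDensity fun p => f p * χ p) {p | θ * (1 - ρ) ≤ u p ∧ u p < θ}).toReal)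
    (hmass : Mw * (((μ.prod ζ).withDensity fun p => f p * χ p) univ).toReal ≤ M * ∑ τ ∈ T, A τ) :
    ∑ τ ∈ T, piece τ ≤ (4 * Real.exp 2 / (1 - δ) * B * M * ρ) * ∑ τ ∈ T, A τ := by
  have hδ1' : -1 < δ := by linarith
  have h1δ : 0 < 1 - δ := by linarith
  have hlam : 0 < (1 + δ) * (ℓ₀ / (1 - δ) + 1 / B) / (1 + δ) - ℓ₀ / (1 - δ) := window_admissible hδ1' hB
  have hac := slotAntiConcentration_local μ ζ (hf.mul hχ) hu hδ0 hδ1 hB.le hθ hθs hρ0 hρ2 hℓ₀ hlam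
    fun z y hy => fibreAlternative_polarDensity_mul hy (hfib z y hy) (hmono z y hy)
  have hle : 2 * fibreCoef δ B ℓ₀ ((1 + δ) * (ℓ₀ / (1 - δ) + 1 / B)) ≤ 4 * Real.exp 2 / (1 - δ) * B := by
    have h := fibreCoef_window_le hδ1 hδ1' hB hBℓ
    calc 2 * fibreCoef δ B ℓ₀ ((1 + δ) * (ℓ₀ / (1 - δ) + 1 / B)) ≤ 2 * (2 * Real.exp 2 * B / (1 - δ)) := by
          linarith
      _ = 4 * Real.exp 2 / (1 - δ) * B := by ring
  exact slot_field_of_massRatio (by positivity) hρ0 (slotAntiConcentration_mono hρ0 hle hac) T hMw hpiece hmass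

end EndToEnd

/-! ## §7  Non-vacuity toys -/

section Toys

/-- the §4 placement FIRES on explicit numbers: `r = p₀ = 0`, `L = 2`, `R ≡ 1` (print's (2.5) with `r = 0`:
`1 = 2⁰` is the least power of `2` above `(log g⁻²)⁰ = 1`), `c₀ = 1`, `A₀ = 1`, `κ = 8`, `s = 1`, window `{0}`,
`g ≡ ρ ≡ 1/2`: the threshold clause reads `4x ≤ 4` on `(0, 1/2]`. [folklore] -/
example : SMPlacement ({0} : Set ℕ) (fun _ => 1) (fun _ => 1 / 2) (fun _ => 1 / 2) 1 8 1 0 := by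
  refine smPlacement_of_localReach (R := fun _ => 1) (c₀ := 1) (L := 2) (r := 0) (g₀ := 1 / 2) (by norm_num)
    (by norm_num) le_rfl (fun x hx hxle => ?_) (fun j _ => ⟨by norm_num, le_rfl⟩) (fun j _ => ?_)
    (fun j _ => ⟨by norm_num, by norm_num⟩) (fun j _ => le_rfl) (by norm_num)
  · simp only [Nat.mul_zero, Nat.add_zero, pow_zero, mul_one, Nat.cast_ofNat]
    nlinarith
  · refine ⟨0, by norm_num, by norm_num, fun s' _ => Nat.zero_le _⟩

/-- the kept-neighbour monotonicity FIRES on the exact linear model `g r = g₀ − r` of the located (AN)-rate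
(`TwoSidedBelow.of_linear`, defect `0`). [folklore] -/
example (g₀ b c : ℝ) (hb : b ≤ c) :
    Monotone fun r => {r : ℝ | g₀ - r < b}.indicator (fun _ => (1 : ℝ≥0∞)) r :=
  monotone_indicator_lt_of_twoSidedBelow (TwoSidedBelow.of_linear g₀ c) zero_le_one hb 1

/-- the union bound of §5 on a two-point space: one dropped co-test failing on a set of relative mass `≤ 1/2`
leaves at least half the mass. [folklore] -/
example (μ' : Measure Bool) [IsFiniteMeasure μ'] (S : Set Bool)
    (hS : μ' S ≤ ENNReal.ofReal (1 / 2) * μ' univ) : μ' univ ≤ 2 * μ' (⋂ i ∈ ({0} : Finset ℕ), Sᶜ) :=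
  measure_univ_le_two_mul_of_unionBound μ' {0} (fun _ => S) (fun _ _ => hS) (by norm_num)

end Toys

/-! ## §8  (v2) The mass ratio PLACED IN KIND: a polylog count of dropped co-tests against the printed large-field
small factor `exp(−c·p₀(g))` is a «g ≤ g₁» clause — parallel to §4's «g ≤ g₀» for (SM)

Printed KIND of the per-test failure fraction (MR-q): B16 = [Balaban1989LargeFieldII] p.387, «κ_k(X) ≧ 0, and we have
the fundamental inequality 𝐓′_k(X)1 ≦ exp(−2(1 + β₀)⁻¹p₀(g_k)). (1.89)», «The inequality (1.80) holds quite generally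
for such regions, hence also an improved bound (1.89)» — typed in tree `Step.FundIneq189` (consumed BY NAME below), with
`p₀(g) = A₀(log g⁻²)^{p₀}` = `Setup.p0Profile A₀ p₀ g` ((2.4); B15 (0.1) p.175 = `Step.exp_neg_p0Profile_eq_rpow`).
Printed KIND of the count (MR-m): the dropped co-tests are those whose determining sets straddle the boundary of the
slot's block, a cube of side a fixed multiple of `R_j` (B14 p.257 «LM₂R_k-cubes», B15 p.177 «a cube of the size
100MR_k»), so their number is `≤ c₃·R_j^ν ≤ c₃L^ν(log g_j⁻²)^{rν}` by (2.5).  Both remain BINDERS (the relative-mass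
READING of (1.89) for the boundary tests under the block × frozen-exterior law; the constants `c₃`, `ν`, `c`); what the
kernel adds is the [folklore] asymptotics `(log g⁻²)ⁿ·exp(−cA₀(log g⁻²)^{p₀}) → 0` and the resulting threshold. -/

section MassRatioPlaced

/-- `A₀·log (x²)⁻¹ ≤ p0Profile A₀ p₀ x` once `log (x²)⁻¹ ≥ 1`, `p₀ ≥ 1`, `A₀ ≥ 0`: the profile (2.4) dominates its
linear truncation on the window. [folklore] -/
theorem mul_log_le_p0Profile {A₀ x : ℝ} (hA₀ : 0 ≤ A₀) {p₀ : ℕ} (hp₀ : 1 ≤ p₀)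
    (hlog : 1 ≤ Real.log (x ^ 2)⁻¹) : A₀ * Real.log (x ^ 2)⁻¹ ≤ p0Profile A₀ p₀ x := by
  unfold p0Profile
  refine mul_le_mul_of_nonneg_left ?_ hA₀
  calc Real.log (x ^ 2)⁻¹ = (Real.log (x ^ 2)⁻¹) ^ 1 := (pow_one _).symm
    _ ≤ (Real.log (x ^ 2)⁻¹) ^ p₀ := pow_le_pow_right₀ hlog hp₀

/-- The small factor against its linear-exponent majorant: `exp(−c·p0Profile A₀ p₀ x) ≤ exp(−(cA₀)·log (x²)⁻¹)`
(`= x^{2cA₀}`) on the window `log (x²)⁻¹ ≥ 1`, for `c, A₀ ≥ 0`, `p₀ ≥ 1`. [folklore] -/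
theorem exp_neg_p0Profile_le_exp_neg_mul_log {A₀ c x : ℝ} (hA₀ : 0 ≤ A₀) (hc : 0 ≤ c) {p₀ : ℕ} (hp₀ : 1 ≤ p₀)
    (hlog : 1 ≤ Real.log (x ^ 2)⁻¹) :
    Real.exp (-(c * p0Profile A₀ p₀ x)) ≤ Real.exp (-(c * A₀ * Real.log (x ^ 2)⁻¹)) := by
  apply Real.exp_le_exp.2
  rw [mul_assoc]
  exact neg_le_neg (mul_le_mul_of_nonneg_left (mul_log_le_p0Profile hA₀ hp₀ hlog) hc)

/-- `(log (x²)⁻¹)ⁿ · exp(−b·log (x²)⁻¹) → 0` as `x → 0⁺` (`b > 0`): any fixed power of `log g⁻²` loses against the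
small factor — Mathlib's `tⁿe^{−t} → 0` (`Real.tendsto_pow_mul_exp_neg_atTop_nhds_zero`) along
`t = b·log (x²)⁻¹ = 2b·log x⁻¹ → +∞`. [folklore] -/
theorem tendsto_logpow_mul_exp_neg_mul_log (n : ℕ) {b : ℝ} (hb : 0 < b) :
    Tendsto (fun x : ℝ => (Real.log (x ^ 2)⁻¹) ^ n * Real.exp (-(b * Real.log (x ^ 2)⁻¹))) (𝓝[>] 0) (𝓝 0) := by
  have ht : Tendsto (fun x : ℝ => b * Real.log (x ^ 2)⁻¹) (𝓝[>] 0) atTop := by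
    have h1 : Tendsto (fun x : ℝ => 2 * b * Real.log x⁻¹) (𝓝[>] 0) atTop :=
      (Real.tendsto_log_atTop.comp tendsto_inv_nhdsGT_zero).const_mul_atTop (by positivity)
    refine h1.congr fun x => ?_
    rw [log_inv_sq_two_mul]; ring
  have h2 := ((Real.tendsto_pow_mul_exp_neg_atTop_nhds_zero n).comp ht).const_mul ((b ^ n)⁻¹)
  rw [mul_zero] at h2
  refine h2.congr fun x => ?_
  have hbn : b ^ n ≠ 0 := pow_ne_zero _ hb.ne'
  simp only [Function.comp_apply, mul_pow]
  field_simp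

/-- **THE (MR) THRESHOLD.**  For every count constant `M`, small-factor constant `c > 0`, `A₀ > 0`, count exponent `n`
and profile exponent `p₀ ≥ 1` there is ONE `g₁ ∈ (0, 1/2]` with
`M·(log (x²)⁻¹)ⁿ·exp(−c·p0Profile A₀ p₀ x) ≤ 1/2` for all `x ∈ (0, g₁]` — the union-bound budget of §5 met for every
coupling below `g₁`, independently of the level, the window and the run. [folklore] -/
theorem exists_threshold_count_smallFactor (M c A₀ : ℝ) (hc : 0 < c) (hA₀ : 0 < A₀) (n : ℕ) {p₀ : ℕ}
    (hp₀ : 1 ≤ p₀) :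
    ∃ g₁ : ℝ, 0 < g₁ ∧ g₁ ≤ 1 / 2 ∧ ∀ x, 0 < x → x ≤ g₁ →
      M * (Real.log (x ^ 2)⁻¹) ^ n * Real.exp (-(c * p0Profile A₀ p₀ x)) ≤ 1 / 2 := by
  have h := ((tendsto_logpow_mul_exp_neg_mul_log n (mul_pos hc hA₀)).const_mul M).eventually_lt_const
    (by rw [mul_zero]; norm_num : M * 0 < 1 / 2)
  obtain ⟨u, hu, hsub⟩ := mem_nhdsGT_iff_exists_Ioc_subset.1 h
  refine ⟨min u (1 / 2), lt_min (Set.mem_Ioi.1 hu) (by norm_num), min_le_right _ _, fun x hx hxle => ?_⟩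
  have hmem := hsub ⟨hx, hxle.trans (min_le_left _ _)⟩
  simp only [Set.mem_setOf_eq] at hmem
  have hlog1 : 1 ≤ Real.log (x ^ 2)⁻¹ :=
    one_le_log_inv_sq_of_le hx (hxle.trans (min_le_right _ _)) one_le_log_four
  have hexp := exp_neg_p0Profile_le_exp_neg_mul_log hA₀.le hc.le hp₀ hlog1
  have hpow : 0 ≤ (Real.log (x ^ 2)⁻¹) ^ n := pow_nonneg (by linarith) _
  rcases le_or_gt 0 M with hM | hM
  · calc M * (Real.log (x ^ 2)⁻¹) ^ n * Real.exp (-(c * p0Profile A₀ p₀ x))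
          ≤ M * (Real.log (x ^ 2)⁻¹) ^ n * Real.exp (-(c * A₀ * Real.log (x ^ 2)⁻¹)) :=
            mul_le_mul_of_nonneg_left hexp (mul_nonneg hM hpow)
      _ = M * ((Real.log (x ^ 2)⁻¹) ^ n * Real.exp (-(c * A₀ * Real.log (x ^ 2)⁻¹))) := by ring
      _ ≤ 1 / 2 := hmem.le
  · have : M * (Real.log (x ^ 2)⁻¹) ^ n * Real.exp (-(c * p0Profile A₀ p₀ x)) ≤ 0 := by
      have h1 : M * (Real.log (x ^ 2)⁻¹) ^ n ≤ 0 := mul_nonpos_iff.2 (Or.inr ⟨hM.le, hpow⟩)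
      exact mul_nonpos_iff.2 (Or.inr ⟨h1, Real.exp_nonneg _⟩)
    linarith

/-- **(MR-m) POLYLOG.**  A count `m ≤ c₃·R^ν` in terms of print's (2.5) size `R` (`B14.IsRj L r g R`:
`R ≤ L(log g⁻²)^r`, `B14FlowStep.isRj_le_mul_logpow`) is a polylog count `m ≤ c₃L^ν·(log g⁻²)^{rν}`. [folklore] -/
theorem count_polylog_of_isRj {m c₃ g : ℝ} {R L r : ℕ} (ν : ℕ) (hL : 1 ≤ L) (hR : B14.IsRj L r g R)
    (hlog : 1 ≤ Real.log (g ^ 2)⁻¹) (hc₃ : 0 ≤ c₃) (hm : m ≤ c₃ * (R : ℝ) ^ ν) :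
    m ≤ c₃ * (L : ℝ) ^ ν * (Real.log (g ^ 2)⁻¹) ^ (r * ν) := by
  have hP1 : 1 ≤ (Real.log (g ^ 2)⁻¹) ^ r := one_le_pow₀ hlog
  have hRle : (R : ℝ) ≤ L * (Real.log (g ^ 2)⁻¹) ^ r := isRj_le_mul_logpow hL hR hP1
  calc m ≤ c₃ * (R : ℝ) ^ ν := hm
    _ ≤ c₃ * ((L : ℝ) * (Real.log (g ^ 2)⁻¹) ^ r) ^ ν :=
        mul_le_mul_of_nonneg_left (pow_le_pow_left₀ (Nat.cast_nonneg _) hRle ν) hc₃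
    _ = c₃ * (L : ℝ) ^ ν * (Real.log (g ^ 2)⁻¹) ^ (r * ν) := by rw [mul_pow, pow_mul]; ring

variable {Ω : Type*} [MeasurableSpace Ω]

/-- **(MR-q) FROM THE PRINTED SHAPE (1.89), BY NAME.**  If the relative `μ′`-mass of a dropped co-test's failure set is
read as (bounded by) a value of a functional `T1X` obeying tree `Step.FundIneq189 T1X A₀ p₀ β₀ g` — B16's
«𝐓′_k(X)1 ≦ exp(−2(1 + β₀)⁻¹p₀(g_k))» for the 𝐓-operation of an arbitrary large-field region — then it is at most the
small factor with `c = 2(1 + β₀)⁻¹`.  The READING (relative failure mass ≤ `T1X v`) is the binder; the lemma is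
monotonicity of `ENNReal.ofReal`. [folklore] -/
theorem fail_le_smallFactor_of_fundIneq189 {V : Type*} {T1X : V → ℝ} {A₀ β₀ g : ℝ} {p₀ : ℕ}
    (h : Step.FundIneq189 T1X A₀ p₀ β₀ g) (v : V) {μ' : Measure Ω} {F : Set Ω}
    (hF : μ' F ≤ ENNReal.ofReal (T1X v) * μ' univ) :
    μ' F ≤ ENNReal.ofReal (Real.exp (-(2 * (1 + β₀)⁻¹ * p0Profile A₀ p₀ g))) * μ' univ :=
  hF.trans (mul_le_mul_of_nonneg_right (ENNReal.ofReal_le_ofReal (h v)) bot_le)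

/-- **(MR) PLACED.**  Below the threshold `g₁` of `exists_threshold_count_smallFactor` (for the count constant `c₃`):
a polylog count of dropped co-tests `card ≤ c₃(log g⁻²)ⁿ`, each failing with relative `μ′`-mass at most the small
factor `exp(−c·p0Profile A₀ p₀ g)`, gives the mass ratio `μ′(everything) ≤ 2·μ′(all pass)` of §5 — at EVERY level
whose coupling is `≤ g₁`. [folklore] -/
theorem massRatio_two_of_smallFactor (μ' : Measure Ω) [IsFiniteMeasure μ'] {κ : Type*} (I : Finset κ)
    (Fail : κ → Set Ω) {c₃ c A₀ g g₁ : ℝ} {n p₀ : ℕ}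
    (hthr : ∀ x, 0 < x → x ≤ g₁ →
      c₃ * (Real.log (x ^ 2)⁻¹) ^ n * Real.exp (-(c * p0Profile A₀ p₀ x)) ≤ 1 / 2)
    (hg : 0 < g ∧ g ≤ g₁) (hcard : (I.card : ℝ) ≤ c₃ * (Real.log (g ^ 2)⁻¹) ^ n)
    (hfail : ∀ i ∈ I, μ' (Fail i) ≤ ENNReal.ofReal (Real.exp (-(c * p0Profile A₀ p₀ g))) * μ' univ) :
    μ' univ ≤ 2 * μ' (⋂ i ∈ I, (Fail i)ᶜ) :=
  measure_univ_le_two_mul_of_unionBound μ' I Fail hfail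
    ((mul_le_mul_of_nonneg_right hcard (Real.exp_nonneg _)).trans (hthr g hg.1 hg.2))

/-- **THE (MR) THRESHOLD, PACKAGED.**  ONE `g₁ ∈ (0, 1/2]`, depending on `(c₃, n, c, A₀, p₀)` only, below which
every finite dominating law with a polylog family of dropped co-tests of small-factor failure fractions has mass
ratio `2` — the (MR) binder of the local member DISCHARGED IN KIND (its count constant/exponent and the relative-mass
reading of (1.89) remain binders). [folklore] -/
theorem exists_threshold_massRatio (c₃ : ℝ) {c A₀ : ℝ} (hc : 0 < c) (hA₀ : 0 < A₀) (n : ℕ) {p₀ : ℕ}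
    (hp₀ : 1 ≤ p₀) :
    ∃ g₁ : ℝ, 0 < g₁ ∧ g₁ ≤ 1 / 2 ∧
      ∀ (μ' : Measure Ω) [IsFiniteMeasure μ'] {κ : Type*} (I : Finset κ) (Fail : κ → Set Ω) (g : ℝ),
        0 < g → g ≤ g₁ → (I.card : ℝ) ≤ c₃ * (Real.log (g ^ 2)⁻¹) ^ n →
        (∀ i ∈ I, μ' (Fail i) ≤ ENNReal.ofReal (Real.exp (-(c * p0Profile A₀ p₀ g))) * μ' univ) →
        μ' univ ≤ 2 * μ' (⋂ i ∈ I, (Fail i)ᶜ) := by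
  obtain ⟨g₁, hg₁, hg₁1, hthr⟩ := exists_threshold_count_smallFactor c₃ c A₀ hc hA₀ n hp₀
  exact ⟨g₁, hg₁, hg₁1, fun μ' _ κ I Fail g hg hgle hcard hfail =>
    massRatio_two_of_smallFactor μ' I Fail hthr ⟨hg, hgle⟩ hcard hfail⟩

/-- **ONE THRESHOLD FOR (SM) AND (MR).**  The minimum of §4's `g₀` (placement of (SM) on branch (A) for the local reach)
and §8's `g₁` serves both clauses: below it, on every window with (2.5)-sizes and local reach, `SMPlacement` holds AND
the union-bound budget `c₃(log g⁻²)ⁿ·exp(−c·p₀(g)) ≤ 1/2` is met — the two «for g sufficiently small» clauses of the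
local member are ONE clause of the printed KIND (`Flow.InInterval F γ K`, `γ ≤ g₂`). [folklore] -/
theorem exists_threshold_joint {A₀ c₀ κ s c₃ c : ℝ} {L : ℕ} (hL : 1 ≤ L) (hA₀ : 0 < A₀) (hκs : 0 < κ * s)
    (hc : 0 < c) (r n : ℕ) {p₀ : ℕ} (hp₀ : 1 ≤ p₀) :
    ∃ g₂ : ℝ, 0 < g₂ ∧ g₂ ≤ 1 / 2 ∧
      (∀ (W : Set ℕ) (C ρ g : ℕ → ℝ) (R : ℕ → ℕ),
        (∀ j ∈ W, 0 < g j ∧ g j ≤ g₂) → (∀ j ∈ W, B14.IsRj L r (g j) (R j)) →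
        (∀ j ∈ W, 0 ≤ C j ∧ C j ≤ c₀ * R j) → (∀ j ∈ W, ρ j ≤ 1 / 2) → SMPlacement W C ρ g A₀ κ s p₀) ∧
      (∀ x, 0 < x → x ≤ g₂ →
        c₃ * (Real.log (x ^ 2)⁻¹) ^ n * Real.exp (-(c * p0Profile A₀ p₀ x)) ≤ 1 / 2) := by
  obtain ⟨g₀, hg₀, hg₀1, hsm⟩ := exists_threshold_smPlacement_local (c₀ := c₀) hL hA₀.le hκs r p₀
  obtain ⟨g₁, hg₁, _, hthr⟩ := exists_threshold_count_smallFactor c₃ c A₀ hc hA₀ n hp₀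
  refine ⟨min g₀ g₁, lt_min hg₀ hg₁, (min_le_left _ _).trans hg₀1, fun W C ρ g R hg hR hC hρ => ?_,
    fun x hx hxle => hthr x hx (hxle.trans (min_le_right _ _))⟩
  exact hsm W C ρ g R (fun j hj => ⟨(hg j hj).1, (hg j hj).2.trans (min_le_left _ _)⟩) hR hC hρ

/-- **THE MASS COMPARISON FROM THE UNION BOUND.**  `μ′(everything) ≤ 2·μ′(all pass)` and the domination of the
all-pass mass by the good term's own weight `Mw·μ′(all pass) ≤ S` (`μ′` with every co-test re-inserted IS that weight)
give the `hmass` binder of §6 with `M = 2`: `Mw·μ′(everything) ≤ 2·S`. [folklore] -/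
theorem mass_le_two_mul_of_unionBound (μ' : Measure Ω) [IsFiniteMeasure μ'] {κ : Type*} (I : Finset κ)
    (Fail : κ → Set Ω) {q : ℝ} (hfail : ∀ i ∈ I, μ' (Fail i) ≤ ENNReal.ofReal q * μ' univ)
    (hm : (I.card : ℝ) * q ≤ 1 / 2) {Mw S : ℝ} (hMw : 0 ≤ Mw)
    (hpass : Mw * (μ' (⋂ i ∈ I, (Fail i)ᶜ)).toReal ≤ S) : Mw * (μ' univ).toReal ≤ 2 * S := by
  have h := measure_univ_le_two_mul_of_unionBound μ' I Fail hfail hm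
  have h2 : (μ' univ).toReal ≤ 2 * (μ' (⋂ i ∈ I, (Fail i)ᶜ)).toReal := by
    have h3 := ENNReal.toReal_mono (ENNReal.mul_ne_top ENNReal.ofNat_ne_top (measure_ne_top μ' _)) h
    rwa [ENNReal.toReal_mul, ENNReal.toReal_ofNat] at h3
  calc Mw * (μ' univ).toReal ≤ Mw * (2 * (μ' (⋂ i ∈ I, (Fail i)ᶜ)).toReal) := mul_le_mul_of_nonneg_left h2 hMw
    _ = 2 * (Mw * (μ' (⋂ i ∈ I, (Fail i)ᶜ)).toReal) := by ring
    _ ≤ 2 * S := by linarith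

variable {E : Type*} [NormedAddCommGroup E] [NormedSpace ℝ E] [MeasurableSpace E] [BorelSpace E]
  [FiniteDimensional ℝ E] [Nontrivial E] (μ : Measure E) [μ.IsAddHaarMeasure]
  {Z : Type*} [MeasurableSpace Z] (ζ : Measure Z) [SFinite ζ]

/-- **THE LOCAL MEMBER WITH THE MASS RATIO PLACED (`M = 2`).**  `slot_field_of_localDilation_sized` with its `hmass`
binder replaced by the union-bound data of the DROPPED co-tests (finitely many failure sets `Fail i` of relative
`μ′`-mass `≤ q`, `card·q ≤ 1/2` — met below `g₁` by `exists_threshold_count_smallFactor` for a polylog count and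
small-factor fractions) and the domination `Mw·μ′(all pass) ≤ Σ_τ A τ`: the slot field with
`D_s = (8e²/(1−δ))·B`. [folklore] -/
theorem slot_field_of_localDilation_placed {ι : Type*} {f χ : E × Z → ℝ≥0∞} (hf : Measurable f)
    (hχ : Measurable χ) [IsFiniteMeasure ((μ.prod ζ).withDensity fun p => f p * χ p)] {u : E × Z → ℝ}
    (hu : Measurable u) {δ s B θ ρ ℓ₀ : ℝ} (hδ0 : 0 ≤ δ) (hδ1 : δ < 1) (hB : 0 < B) (hθ : 0 < θ) (hθs : θ ≤ s)
    (hρ0 : 0 ≤ ρ) (hρ2 : ρ ≤ 1 / 2) (hℓ₀ : -Real.log (1 - ρ) ≤ ℓ₀) (hBℓ : B * ℓ₀ ≤ (1 - δ) / 2)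
    (hfib : ∀ z, ∀ y : E, ‖y‖ = 1 →
      FibreAlternative (polarDensity (Module.finrank ℝ E) fun x => f (x, z)) ((fun x => u (x, z)) ∘ dilate)
        δ s B θ ρ ((1 + δ) * (ℓ₀ / (1 - δ) + 1 / B)) y)
    (hmono : ∀ z, ∀ y : E, ‖y‖ = 1 → Monotone fun r : ℝ => χ (Real.exp (-r) • y, z))
    (T : Finset ι) {piece A : ι → ℝ} {Mw : ℝ} (hMw : 0 ≤ Mw)
    (hpiece : ∑ τ ∈ T, piece τ ≤
      Mw * (((μ.prod ζ).withDensity fun p => f p * χ p) {p | θ * (1 - ρ) ≤ u p ∧ u p < θ}).toReal)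
    {κ : Type*} (I : Finset κ) (Fail : κ → Set (E × Z)) {q : ℝ}
    (hfail : ∀ i ∈ I, ((μ.prod ζ).withDensity fun p => f p * χ p) (Fail i) ≤
      ENNReal.ofReal q * ((μ.prod ζ).withDensity fun p => f p * χ p) univ)
    (hm : (I.card : ℝ) * q ≤ 1 / 2)
    (hpass : Mw * (((μ.prod ζ).withDensity fun p => f p * χ p) (⋂ i ∈ I, (Fail i)ᶜ)).toReal ≤ ∑ τ ∈ T, A τ) :
    ∑ τ ∈ T, piece τ ≤ (8 * Real.exp 2 / (1 - δ) * B * ρ) * ∑ τ ∈ T, A τ := by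
  have h := slot_field_of_localDilation_sized μ ζ hf hχ hu hδ0 hδ1 hB hθ hθs hρ0 hρ2 hℓ₀ hBℓ hfib hmono T hMw
    hpiece (M := 2) (mass_le_two_mul_of_unionBound _ I Fail hfail hm hMw hpass)
  calc ∑ τ ∈ T, piece τ ≤ (4 * Real.exp 2 / (1 - δ) * B * 2 * ρ) * ∑ τ ∈ T, A τ := h
    _ = (8 * Real.exp 2 / (1 - δ) * B * ρ) * ∑ τ ∈ T, A τ := by ring

/-- the §8 placement FIRES on explicit numbers: count constant `c₃ = 1`, count exponent `n = 0`, small-factor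
constant `c = 1`, `A₀ = 1`, `p₀ = 3`: on `(0, 1/2]` one has `p₀(x) = (log (x²)⁻¹)³ ≥ 1`, so the budget reads
`exp(−p₀(x)) ≤ e⁻¹ ≤ 1/2`; hence ONE dropped co-test with a small-factor failure fraction leaves mass ratio `2` at
coupling `1/2`. [folklore] -/
example (μ' : Measure Bool) [IsFiniteMeasure μ'] (S : Set Bool)
    (hS : μ' S ≤ ENNReal.ofReal (Real.exp (-(1 * p0Profile 1 3 (1 / 2)))) * μ' univ) :
    μ' univ ≤ 2 * μ' (⋂ i ∈ ({0} : Finset ℕ), Sᶜ) := by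
  refine massRatio_two_of_smallFactor μ' {0} (fun _ => S) (c₃ := 1) (n := 0) (g₁ := 1 / 2)
    (fun x hx hxle => ?_) ⟨by norm_num, le_rfl⟩ (by simp) (fun _ _ => hS)
  have hlog1 : 1 ≤ Real.log (x ^ 2)⁻¹ := one_le_log_inv_sq_of_le hx hxle one_le_log_four
  have hP : 1 ≤ p0Profile 1 3 x := by
    unfold p0Profile; rw [one_mul]; exact one_le_pow₀ hlog1
  have h2 : (2 : ℝ) ≤ Real.exp 1 := by have := Real.add_one_le_exp (1 : ℝ); linarith
  have he : Real.exp (-1) ≤ 1 / 2 := by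
    rw [Real.exp_neg, inv_le_comm₀ (Real.exp_pos 1) (by norm_num)]
    have h' : (1 / 2 : ℝ)⁻¹ = 2 := by norm_num
    rw [h']; exact h2
  have hexp : Real.exp (-(1 * p0Profile 1 3 x)) ≤ Real.exp (-1) := Real.exp_le_exp.2 (by linarith)
  simp only [pow_zero, mul_one, one_mul] at hexp ⊢
  linarith

/-- the (MR-m) polylog count FIRES on print's (2.5) toy `L = 2`, `r = 0`, `R = 1`: a count `≤ 5·1³` is
`≤ 5·2³·(log g⁻²)⁰`. [folklore] -/
example (g : ℝ) (hlog : 1 ≤ Real.log (g ^ 2)⁻¹) : (5 : ℝ) ≤ 5 * (2 : ℕ) ^ 3 * (Real.log (g ^ 2)⁻¹) ^ (0 * 3) := by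
  have h := count_polylog_of_isRj (m := 5) (c₃ := 5) (R := 1) (L := 2) (r := 0) 3 (by norm_num)
    ⟨0, by norm_num, by norm_num, fun s' _ => Nat.zero_le _⟩ hlog (by norm_num) (by norm_num)
  exact_mod_cast h

end MassRatioPlaced


end Literature.MathematicalPhysics.QuantumFieldTheory.Balaban1983to89.T4ShellMeasureLocal
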